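import Summits.QuantumFields.QCD.Theorems.WilsonMobilityGapChiralMobilityGapAnchorDefs
import Summits.QuantumFields.QCD.Theorems.WilsonMobilityGapChiralMobilityGapAnchorStubSuperLog
import Summits.QuantumFields.QCD.Theorems.WilsonMobilityGapChiralMobilityGapAnchorMoments

/-!
# Crux `ChiralMobilityGap` (stmt-QuantumFields-17497) — line `Ideator3Sketch` (card
# `sign-threshold-anchor`): scope of the anchored witness — super-log volumes, the TRANSFER
# `core stubs → crux`, and the honesty record `vanishing chiral rate → LightMomentFree`

Helper file of the line lead (prover-line-stmt-QuantumFields-17497-c1-0), pure logic over landed files: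

* `anchorReg_superLogVolume` (registered sub-goal) — the explicit volumes `L_k = (k+2)⌈log(k+2)⌉²` of
  `anchorReg` are super-logarithmic, `a_k L_k / log(L_k + 2) → ∞` (the landed analysis stub
  `stub_superLog`, p136917, read through the definitions of `anchorReg`, p137198);
* `chiralMobilityGap_of_anchorCore` — THE TRANSFER of the registered skeleton
  `Cruxes/ChiralMobilityGap/Lines/Ideator3Sketch.lean` v3, kernel-checked here as a conditional:
  the crux `ChiralMobilityGap` follows BY NAME from the three CLOSED statements about the one explicit
  regularisation `anchorReg` that remain registered as stubs — (ii) UPPER and (iii) LOWER for every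
  positive mass tuple, and the vanishing chiral rate along degenerate tuples — everything else
  (both scalings, clauses (i) and (iv), the `N_f = 3` pion-weight sign input, super-log volumes, the
  pin lemmas) being landed;
* `lightMomentFree_of_vanishingChiralRate`, `lightMomentFree_of_anchorReg_vcr` — honesty record: the
  vanishing-chiral-rate stub ALONE already contains the kernel-necessary infrared core
  `LightMomentFree` of the support crux `MobilityGap` (stmt-QuantumFields-9150), for which no mechanism
  is on file (`Cruxes/MobilityGap/Lines/Sketch-dead.md`);
* `vcr_anchorReg_of_fm_two_three` — the `N_f ≥ 3` refinement of `stub_vcr` for the anchored witness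
  (landed `vanishingChiralRate_of_fm_two_three`, p137915, instantiated): a vanishing-rate floor for the
  SECOND moment `fm(2)` (phase-quenched pion correlator) plus no third-moment broadening along the
  anchored diagonal suffice.
-/

noncomputable section

namespace Summit.QuantumFields.QCD.Theorems.ChiralMobilityGapAnchor

open scoped Topology
open Filter
open Literature.MathematicalPhysics.QuantumFieldTheory
open Summit.QuantumFields.QCD.Theorems.MobilityGapNegative (ClauseI Upper Lower Clauses)
open Summit.QuantumFields.QCD.Theorems.ChiralMobilityGapSketch (VanishingChiralRate SuperLogVolume
  isChiralAtZero_two isChiralAtZero_three)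
open Summit.QuantumFields.QCD.Theorems.MobilityGapSketch (LightMomentFree lightMomentFree_of_clauseI_lower)

/-- **Super-logarithmic volumes of the anchored witness** (registered sub-goal): for every `N_f`,
`a_k L_k / log(L_k + 2) → ∞` along `anchorReg N_f` — the landed `stub_superLog` with
`a_k = 1/(k+2)`, `L_k = (k+2)⌈log(k+2)⌉²` unfolded. -/
theorem anchorReg_superLogVolume : ∀ Nf : ℕ, SuperLogVolume (anchorReg Nf) := by
  intro Nf
  unfold SuperLogVolume
  refine stub_superLog.congr fun k => ?_
  simp [anchorA, anchorSide]

/-- The clause package of the anchored witness from the two clause-level core statements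
((ii) UPPER and (iii) LOWER for all positive tuples); scalings, (i) and (iv) are landed. -/
theorem clauses_anchorReg_of {Nf : ℕ}
    (hU : ∀ m : Fin Nf → ℝ, (∀ f, 0 < m f) → Upper (anchorReg Nf) m)
    (hL : ∀ m : Fin Nf → ℝ, (∀ f, 0 < m f) → Lower (anchorReg Nf) m) :
    Clauses Nf (anchorReg Nf) :=
  ⟨anchorReg_hasMassScaling, anchorReg_hasAsymptoticScaling, fun m hm =>
    ⟨anchorReg_clauseI m hm, hU m hm, hL m hm, anchorReg_sign m hm⟩⟩

/-- **THE TRANSFER (conditional form of the skeleton's `ChiralMobilityGap_of`).** If the explicit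
anchored regularisation `anchorReg N_f` carries, for `N_f = 2, 3`, clause (ii) UPPER and clause
(iii) LOWER at every positive mass tuple and a vanishing chiral rate along degenerate tuples, then
`ChiralMobilityGap` (stmt-QuantumFields-17497) holds — with `anchorReg` as the witness: it is chiral
at zero by the landed pin lemmas (`N_f = 2`: `isChiralAtZero_two`; `N_f = 3`: `isChiralAtZero_three`
with the clause package, super-log volumes and the pion-weight sign input, the last two landed for
this witness), and (i), (iv), both scalings are landed.  The three hypotheses are VERBATIM the
registered stubs `stub_upper`, `stub_lower`, `stub_vcr` of the line. -/
theorem chiralMobilityGap_of_anchorCore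
    (hU : ∀ Nf : ℕ, Nf = 2 ∨ Nf = 3 → ∀ m : Fin Nf → ℝ, (∀ f, 0 < m f) → Upper (anchorReg Nf) m)
    (hL : ∀ Nf : ℕ, Nf = 2 ∨ Nf = 3 → ∀ m : Fin Nf → ℝ, (∀ f, 0 < m f) → Lower (anchorReg Nf) m)
    (hV : ∀ Nf : ℕ, Nf = 2 ∨ Nf = 3 → VanishingChiralRate (anchorReg Nf)) :
    Summit.QuantumFields.QCD.Theses.WilsonMobilityGap.ChiralMobilityGap := by
  rw [WilsonMobilityGap.chiralMobilityGap_iff]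
  intro Nf hNf
  rcases hNf with rfl | rfl
  · exact ⟨anchorReg 2, isChiralAtZero_two _ (hV 2 (Or.inl rfl)),
      clauses_anchorReg_of (hU 2 (Or.inl rfl)) (hL 2 (Or.inl rfl))⟩
  · have hC : Clauses 3 (anchorReg 3) := clauses_anchorReg_of (hU 3 (Or.inr rfl)) (hL 3 (Or.inr rfl))
    exact ⟨anchorReg 3, isChiralAtZero_three _ hC (anchorReg_superLogVolume 3)
      anchorReg_pionWeightSignCoherent (hV 3 (Or.inr rfl)), hC⟩

/-- **Honesty record, general form.** For ANY regularisation with two-loop asymptotic scaling whose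
degenerate positive tuples satisfy clause (i), a vanishing chiral rate already yields the open
infrared core `LightMomentFree N_f` of the support crux (instantiate `VanishingChiralRate` at `ε = 1`
and feed the resulting clause-(iii) datum to `lightMomentFree_of_clauseI_lower`). -/
theorem lightMomentFree_of_vanishingChiralRate {Nf : ℕ} (hNf : 0 < Nf) (reg : QCDRegularisation Nf)
    (hAS : (reg.scheme 0 0 0).HasAsymptoticScaling)
    (hI : ∀ t : ℝ, 0 < t → ClauseI reg (fun _ => t)) (hV : VanishingChiralRate reg) :
    LightMomentFree Nf := by
  obtain ⟨t, ht, s, c₀, C₁, p, hs, hs1, hc₀, -, hLow⟩ := hV 1 one_pos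
  exact lightMomentFree_of_clauseI_lower hNf reg hAS t (hI t ht) ⟨s, c₀, C₁, p, hs, hs1, hc₀, hLow⟩

/-- **Honesty record for the line.** The stub `stub_vcr` alone (vanishing chiral rate along the
anchored witness) implies `LightMomentFree N_f` (`N_f ≥ 1`): both side conditions of the general form
are landed for `anchorReg` (`anchorReg_hasAsymptoticScaling`, `anchorReg_clauseI`). -/
theorem lightMomentFree_of_anchorReg_vcr {Nf : ℕ} (hNf : 0 < Nf)
    (hV : VanishingChiralRate (anchorReg Nf)) : LightMomentFree Nf :=
  lightMomentFree_of_vanishingChiralRate hNf (anchorReg Nf) anchorReg_hasAsymptoticScaling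
    (fun t ht => anchorReg_clauseI (fun _ => t) fun _ => ht) hV

/-- **`stub_vcr` for the anchored witness with `N_f ≥ 3` from second and third moments** (the landed
reduction `vanishingChiralRate_of_fm_two_three` instantiated at `anchorReg N_f`): it suffices that for
every `ε > 0` some `t > 0` carries, along the anchored degenerate trajectory, an exponential floor
`c e^{-(μ a_k n + q log(n+1))} ≤ fm(2)` with `μ < ε` and no broadening `fm(3) ≤ K e^{q' log(n+1)} fm(2)^{3/2}`. -/
theorem vcr_anchorReg_of_fm_two_three {Nf : ℕ} (hNf : 3 ≤ Nf)
    (h : ∀ ε > (0 : ℝ), ∃ t : ℝ, 0 < t ∧ ∃ c μ q : ℝ, 0 < c ∧ μ < ε ∧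
      (∀ᶠ k in atTop, ∀ S : ℕ, (anchorReg Nf).L k ≤ S → ∀ (f : Fin Nf) (n : ℕ), n ≤ S →
        c * Real.exp (-(μ * ((anchorReg Nf).a k * n) + q * Real.log (n + 1))) ≤
          MobilityGapNegative.fm Nf ((anchorReg Nf).β k) (MobilityGapNegative.bare (anchorReg Nf) (fun _ => t) k)
            S f (Pi.single 0 (n : ℤ)) 2) ∧
      ∃ K q' : ℝ, 0 < K ∧
        ∀ᶠ k in atTop, ∀ S : ℕ, (anchorReg Nf).L k ≤ S → ∀ (f : Fin Nf) (n : ℕ), n ≤ S →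
          MobilityGapNegative.fm Nf ((anchorReg Nf).β k) (MobilityGapNegative.bare (anchorReg Nf) (fun _ => t) k)
              S f (Pi.single 0 (n : ℤ)) 3 ≤
            K * Real.exp (q' * Real.log (n + 1)) *
              MobilityGapNegative.fm Nf ((anchorReg Nf).β k)
                (MobilityGapNegative.bare (anchorReg Nf) (fun _ => t) k) S f (Pi.single 0 (n : ℤ)) 2 ^ (3 / 2 : ℝ)) :
    VanishingChiralRate (anchorReg Nf) :=
  vanishingChiralRate_of_fm_two_three hNf (anchorReg Nf) h

end Summit.QuantumFields.QCD.Theorems.ChiralMobilityGapAnchor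

end
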